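import Literature.NumberTheory.Congruences.BernoulliTeichmullerCongruence
import Mathlib.NumberTheory.DirichletCharacter.Basic
import HarnessLib

/-!
# The Kummer congruence with a tame character:
# `B_{1,χω^{k-1}} ≡ (1/k) B_{k,χ} (mod p)` for `2 ≤ k ≤ p − 2`, `χ` modulo `N`, `p ∤ N`

Topic `Literature/NumberTheory/Congruences`; namespace
`Literature.NumberTheory.Congruences.CharacterTwist`.  THEOREMS ONLY (no definition, no named
fact, no instance).

Let `p` be an odd prime, `ω` the Teichmüller character modulo `p` (`ω(a) ≡ a (mod p)`), `N ≥ 1`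
an integer prime to `p` and `χ` a Dirichlet character modulo `N` with values in `ℚ_p` (for
instance a quadratic character).  For `2 ≤ k ≤ p − 2` the generalized Bernoulli numbers of
Leopoldt (`B_{k,χ} = N^{k-1} ∑_{a mod N} χ(a) B_k(a/N)`, Lang Ch. 2 §2 **B 7**, Diamond–Shurman
(4.30) = the tree's `LFunctions.generalizedBernoulli`) satisfy

  `B_{1,χω^{k-1}} ≡ (1/k) B_{k,χ} (mod p)`,   `(1/k) B_{k,χ} ∈ ℤ_p`,

where `χω^{k-1}` is the character modulo `Np` (the tree's `changeLevel χ * changeLevel ω^{k-1}`)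
and "`≡ (mod p)`" between elements of `ℚ_p` is `‖· − ·‖_p < 1`.  This is the twist by `χ` of
Lang's Theorem 2.5 (Ch. 2 §2, the case `χ = 1`, `n = 1`: `B_{1,ω^{k-1}} ≡ (1/k) B_k (mod p)`,
formalised in `Congruences/BernoulliTeichmullerCongruence.lean`), equivalently the congruence
`L_p(0, χω^k) ≡ L_p(1 − k, χω^k) (mod p)` between two special values of the Kubota–Leopoldt
`p`-adic `L`-function (Washington Thm. 5.11 `L_p(1−n, θ) = −(1 − θω^{−n}(p)p^{n−1}) B_{n,θω^{−n}}/n`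
with Cor. 5.13, at `θ = χω^k`, `n ∈ {1, k}`; Lang Ch. 4 §3 Thm. 3.2), the Euler factor
`1 − χ(p)p^{k−1}` being `≡ 1` for `k ≥ 2`.

ROAD (Lang's proof of Thm. 2.5, at tame level `Np` instead of `p`, on the tree's formalisation of
Lang Ch. 2 §2 / Ch. 4 §3 — the measures `θE_{k,c}` = `EllipticCurves.bernoulliMeasure`):
the two `Np`-periodic multiplicative twists `θ₁ = χ·ω^{k-1}` and `θ₂ = χ` (the latter `N`-periodic,
read at level `Np`) have total masses (Thm. 2.4, `bernoulliMeasure_zero_eq`)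
`(θ₁E_{1,c})(ℤ_p) = (1 − θ₁(c)c) B_{1,χω^{k-1}}` and
`(θ₂E_{k,c})(ℤ_p) = (1/k)(1 − χ(c)c^k) B_{k,χ}` (the level-`Np` sum collapses to level `N` by the
distribution relation `sum_fiber_bernoulliDist`); both masses are limits of Riemann sums of
`x^0·θ₁`, resp. `x^{k-1}·θ₂`, against `E_{1,c}` (Thm. 2.2, `exists_norm_bernoulliMeasure_zero_sub_sum_le`),
whose integrands are congruent modulo `p` termwise (`ω^{k-1}(y) ≡ x^{k-1}` for `x ≡ y`, both sides
`≡ 0` when `p ∣ y` since `k ≥ 2`), so the masses are congruent (§1, the tame-level version of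
`TeichmullerTwist.norm_bernoulliMeasure_zero_sub_lt_one`); finally `c` is chosen `≡ 1 (mod N)` and a
primitive root mod `p` (Chinese remainder), so that `χ(c) = 1` and the two prefactors
`1 − ω^{k-1}(c)c ≡ 1 − c^k` are congruent `p`-units (`c^k ≢ 1` as `0 < k < p − 1`).

Main statements (all with `hN : N.Coprime p`, `χ : DirichletCharacter ℚ_[p] N`,
`ω : DirichletCharacter ℚ_[p] p` with `‖ω(a) − a‖_p < 1` for `p ∤ a`, `2 ≤ k ≤ p − 2`):

* `norm_generalizedBernoulli_div_le_one` — `‖(1/k) B_{k,χ}‖_p ≤ 1` (no `ω` needed);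
* `norm_generalizedBernoulli_one_sub_div_lt_one` — **`‖B_{1,χω^{k-1}} − (1/k) B_{k,χ}‖_p < 1`**;
* `norm_generalizedBernoulli_one_le_one` — `‖B_{1,χω^{k-1}}‖_p ≤ 1`;
* `norm_generalizedBernoulli_one_lt_one_iff` — `p ∣ B_{1,χω^{k-1}} ⟺ p ∣ (1/k) B_{k,χ}`
  (`‖·‖_p < 1` on both sides), the form used to read Bernoulli-unit hypotheses on characters
  `χ·ω^{j}` (Herbrand–Ribet, Mazur–Wiles, Kriz–Li (4)) as divisibilities of `B_{j+1,χ}/(j+1) =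
  −L(−j, χ)` (for quadratic `χ` of conductor `|D|`: Cohen's numbers `H(j+1, |D|)` up to sign);
* the pointwise reading of the product character
  `changeLevel_mul_changeLevel_apply_natCast` (`(χ↑·ψ↑)(b) = χ(b)ψ(b)` for all `b ∈ ℕ` at coprime
  levels — also off the units) and the two sum identities `generalizedBernoulli_one_mul_eq_sum`,
  `sum_castHom_mul_bernoulliDist_eq` used to identify the masses.

## Honest column

* SCOPE: `χ` takes values in `ℚ_p` (so its order divides `p − 1`); Washington/Lang allow values in
  `𝒪_{ℚ_p(χ)}` — TODO(general form): `χ` with values in a finite extension of `ℚ_p` (same proof with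
  `𝒪`-valued measures).  The range `2 ≤ k ≤ p − 2` is Lang's (`k = p − 1` would need `χ ≠ 1`;
  `k ≡ 1 (mod p−1)` is the pole `B_{1,ω⁻¹χ}`); `p ≠ 2` is automatic.  The Euler factor
  `(1 − χ(p)p^{k−1})` of Washington Thm. 5.11 does not appear because `k ≥ 2`.
* Not here: higher congruences modulo `p^e`, the `p`-adic `L`-function itself, `p = 2`.

## References

* S. Lang, *Cyclotomic Fields I and II*, GTM 121, Springer 1990, Ch. 2 §2 Thms 2.2, 2.4, 2.5 and
  their proofs (PDF pp. 36–39); Ch. 4 §3 Thm. 3.2 (PDF p. 84). [LangCyclotomic1990]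
* L. C. Washington, *Introduction to Cyclotomic Fields*, 2nd ed., GTM 83, Springer 1997, Thm. 5.11,
  Thm. 5.12, Cor. 5.13 (pp. 57–61). [Washington1997]
-/

noncomputable section

open Finset Literature.NumberTheory.EllipticCurves Literature.NumberTheory.LFunctions
  DirichletCharacter

namespace Literature.NumberTheory.Congruences.CharacterTwist

variable {p : ℕ} [hp : Fact p.Prime]

/-! ### §1. Congruent integrands at an arbitrary tame level `M` -/

section Congruence

variable {M : ℕ} [NeZero M] {c : ℕ} {θ θ' : ℕ → ℤ_[p]}

omit hp [NeZero M] in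
/-- `c` prime to `Mp` is prime to `M p^m`. [folklore] -/
private theorem coprime_mul_pow (hc : c.Coprime (M * p)) (m : ℕ) : c.Coprime (M * p ^ m) :=
  Nat.Coprime.mul_right (Nat.Coprime.coprime_mul_right_right hc)
    (Nat.Coprime.pow_right _ (Nat.Coprime.coprime_mul_left_right hc))

/-- A multiple of `p` in `ℤ_p` has norm `≤ 1/p`. [folklore] -/
private theorem norm_le_inv_of_dvd {z : ℤ_[p]} (hz : (p : ℤ_[p]) ∣ z) : ‖z‖ ≤ (p : ℝ)⁻¹ := by
  obtain ⟨w, rfl⟩ := hz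
  rw [norm_mul, PadicInt.norm_p]
  exact mul_le_of_le_one_right (inv_nonneg.mpr (Nat.cast_nonneg p)) (PadicInt.norm_le_one w)

/-- **Congruent integrands have congruent Riemann sums, at any tame level `M`** (Lang's proof of
Thm. 2.5: "the expression in brackets under the integral sign is `≡ 0 (mod p)`"): if
`x^i θ(y) ≡ x^j θ'(y) (mod p)` whenever `x ≡ y (mod p)`, then for `m ≥ 1`
`‖∑_{a mod p^m} a^i (θE_{1,c})(a + p^m) − ∑_{a mod p^m} a^j (θ'E_{1,c})(a + p^m)‖_p ≤ 1/p` for the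
measures `θE_{1,c}`, `θ'E_{1,c}` of tame level `M` (values of `E_{1,c}` `p`-integral, Thm. 2.1 (i)).
The tree's `TeichmullerTwist.norm_sum_sub_sum_le` is the case `M = p`.
[cite: LangCyclotomic1990, Ch. 2 §2, proof of Thm. 2.5] -/
theorem norm_sum_sub_sum_le_level (hp2 : p ≠ 2) (hc : c.Coprime (M * p)) {i j : ℕ}
    (H : ∀ x y : ℕ, x ≡ y [MOD p] →
      ‖((x : ℤ_[p]) ^ i * θ y - (x : ℤ_[p]) ^ j * θ' y)‖ ≤ (p : ℝ)⁻¹)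
    {m : ℕ} (hm : 1 ≤ m) :
    ‖∑ a : ZMod (p ^ m), ((a.val : ℕ) : ℚ_[p]) ^ i * bernoulliMeasure p M c θ 1 m a -
        ∑ a : ZMod (p ^ m), ((a.val : ℕ) : ℚ_[p]) ^ j * bernoulliMeasure p M c θ' 1 m a‖ ≤
      (p : ℝ)⁻¹ := by
  have hc' : c.Coprime (M * p ^ m) := coprime_mul_pow hc m
  have h0 : (0 : ℝ) ≤ (p : ℝ)⁻¹ := inv_nonneg.mpr (Nat.cast_nonneg p)
  unfold bernoulliMeasure
  simp_rw [Finset.mul_sum]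
  rw [← Finset.sum_sub_distrib]
  refine IsUltrametricDist.norm_sum_le_of_forall_le_of_nonneg h0 fun a _ ↦ ?_
  rw [← Finset.sum_sub_distrib]
  refine IsUltrametricDist.norm_sum_le_of_forall_le_of_nonneg h0 fun b hb ↦ ?_
  have hb' := (Finset.mem_filter.mp hb).2
  -- `a.val ≡ b.val (mod p)`
  have hab : a.val ≡ b.val [MOD p] := by
    have h := congr_arg ZMod.val hb'
    rw [ZMod.castHom_apply, ZMod.cast_eq_val, ZMod.val_natCast] at h
    have h1 : b.val ≡ a.val [MOD p ^ m] := by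
      rw [← h]
      exact (Nat.mod_modEq _ _).symm
    exact (h1.of_dvd (dvd_pow_self p (by omega))).symm
  set E := (((regBernoulliDist 1 (M * p ^ m) c b / (1 : ℕ) : ℚ)) : ℚ_[p]) with hE
  have hEle : ‖E‖ ≤ 1 := by
    rw [hE, Nat.cast_one, div_one]
    exact norm_regBernoulliDist_one_le_one p hp2 hc' b
  have key : ((a.val : ℕ) : ℚ_[p]) ^ i * (((θ b.val : ℤ_[p]) : ℚ_[p]) * E) -
      ((a.val : ℕ) : ℚ_[p]) ^ j * (((θ' b.val : ℤ_[p]) : ℚ_[p]) * E) =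
      ((((a.val : ℕ) : ℤ_[p]) ^ i * θ b.val - ((a.val : ℕ) : ℤ_[p]) ^ j * θ' b.val : ℤ_[p]) :
        ℚ_[p]) * E := by
    push_cast
    ring
  rw [key, norm_mul, PadicInt.padic_norm_e_of_padicInt]
  calc _ ≤ (p : ℝ)⁻¹ * 1 := mul_le_mul (H _ _ hab) hEle (norm_nonneg _) h0
    _ = _ := mul_one _

/-- **Congruence of the total masses at tame level `M`** (Lang's proof of Thm. 2.5 before the
prefactors are removed): for `M`-periodic `θ, θ'` with `x^i θ(y) ≡ x^j θ'(y) (mod p)` whenever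
`x ≡ y (mod p)`, `‖(θE_{i+1,c})(ℤ_p) − (θ'E_{j+1,c})(ℤ_p)‖_p < 1`, i.e.
`∫ θ x^{i} dE_{1,c} ≡ ∫ θ' x^{j} dE_{1,c} (mod p)`. [cite: LangCyclotomic1990, Ch. 2 §2, proof of Thm. 2.5] -/
theorem norm_bernoulliMeasure_zero_sub_lt_one_level (hp2 : p ≠ 2) (hc : c.Coprime (M * p))
    (hθ : ∀ b, θ (b + M) = θ b) (hθ' : ∀ b, θ' (b + M) = θ' b) {i j : ℕ}
    (H : ∀ x y : ℕ, x ≡ y [MOD p] →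
      ‖((x : ℤ_[p]) ^ i * θ y - (x : ℤ_[p]) ^ j * θ' y)‖ ≤ (p : ℝ)⁻¹) :
    ‖bernoulliMeasure p M c θ (i + 1) 0 0 - bernoulliMeasure p M c θ' (j + 1) 0 0‖ < 1 := by
  obtain ⟨C₁, -, h₁⟩ := TeichmullerTwist.exists_norm_bernoulliMeasure_zero_sub_sum_le
    (N := M) (θ := θ) hp2 hc hθ (by omega : 1 ≤ i + 1)
  obtain ⟨C₂, -, h₂⟩ := TeichmullerTwist.exists_norm_bernoulliMeasure_zero_sub_sum_le
    (N := M) (θ := θ') hp2 hc hθ' (by omega : 1 ≤ j + 1)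
  have hp1 : (1 : ℝ) < p := by exact_mod_cast hp.out.one_lt
  obtain ⟨m₀, hm₀⟩ := pow_unbounded_of_one_lt (max C₁ C₂) hp1
  set m := m₀ + 1 with hm
  have hpm : max C₁ C₂ < (p : ℝ) ^ m :=
    hm₀.trans_le (pow_le_pow_right₀ hp1.le (Nat.le_succ m₀))
  have hsmall : ∀ {C : ℝ}, C ≤ max C₁ C₂ → C * (p : ℝ) ^ (-(m : ℤ)) < 1 := by
    intro C hC
    rw [zpow_neg, zpow_natCast, ← div_eq_mul_inv, div_lt_one (by positivity)]
    exact hC.trans_lt hpm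
  have hpinv : (p : ℝ)⁻¹ < 1 := inv_lt_one_of_one_lt₀ hp1
  set S₁ := ∑ a : ZMod (p ^ m), ((a.val : ℕ) : ℚ_[p]) ^ (i + 1 - 1) * bernoulliMeasure p M c θ 1 m a
  set S₂ := ∑ a : ZMod (p ^ m), ((a.val : ℕ) : ℚ_[p]) ^ (j + 1 - 1) * bernoulliMeasure p M c θ' 1 m a
  have hS : ‖S₁ - S₂‖ ≤ (p : ℝ)⁻¹ := by
    simpa only [S₁, S₂, Nat.add_sub_cancel] using
      norm_sum_sub_sum_le_level hp2 hc H (by omega : 1 ≤ m)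
  have e : bernoulliMeasure p M c θ (i + 1) 0 0 - bernoulliMeasure p M c θ' (j + 1) 0 0 =
      (bernoulliMeasure p M c θ (i + 1) 0 0 - S₁) + ((S₁ - S₂) -
        (bernoulliMeasure p M c θ' (j + 1) 0 0 - S₂)) := by ring
  rw [e]
  refine (IsUltrametricDist.norm_add_le_max _ _).trans_lt (max_lt ?_ ?_)
  · exact (h₁ m).trans_lt (hsmall (le_max_left _ _))
  · have hsub : ∀ x y : ℚ_[p], ‖x - y‖ ≤ max ‖x‖ ‖y‖ := fun x y ↦ by
      simpa only [sub_eq_add_neg, norm_neg] using IsUltrametricDist.norm_add_le_max x (-y)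
    refine (hsub _ _).trans_lt (max_lt (hS.trans_lt hpinv) ?_)
    exact (h₂ m).trans_lt (hsmall (le_max_right _ _))

end Congruence

/-! ### §2. Characters with values in `ℚ_p`; the product character `χ↑·ψ↑` pointwise -/

section Values

/-- A value of a `ℚ_p`-valued Dirichlet character has norm `≤ 1` (it is `0` or a root of unity,
and the roots of unity of `ℚ_p` lie in `ℤ_p^×`).
[cite: Gouvea1993PadicNumbers, §5.8 (the roots of unity `V ⊂ ℤ_p^×`, printed pp. 153–154)] [cite: Washington1997, §5.1 (values of Dirichlet characters in `ℤ_p`)] -/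
theorem norm_apply_le_one {n : ℕ} (χ : DirichletCharacter ℚ_[p] n) (b : ZMod n) : ‖χ b‖ ≤ 1 := by
  by_cases hb : IsUnit b
  · obtain ⟨u, rfl⟩ := hb
    have hfin : IsOfFinOrder (χ.toUnitHom u) := MonoidHom.isOfFinOrder _ (isOfFinOrder_of_finite u)
    obtain ⟨k, hk, hpow⟩ := hfin.exists_pow_eq_one
    have hval : (χ (u : ZMod n)) ^ k = 1 := by
      have := congr_arg (fun x : ℚ_[p]ˣ ↦ (x : ℚ_[p])) hpow
      simpa [MulChar.coe_toUnitHom] using this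
    have hn : ‖χ (u : ZMod n)‖ ^ k = 1 := by rw [← norm_pow, hval, norm_one]
    exact (pow_eq_one_iff_of_nonneg (norm_nonneg _) hk.ne').mp hn |>.le
  · rw [χ.map_nonunit hb, norm_zero]
    exact zero_le_one

/-- **The product character `χ↑ · ψ↑` modulo `NM`, pointwise at every natural number** (not only at
the units): for `χ` mod `N` and `ψ` mod `M`, `(χ↑·ψ↑)(b) = χ(b)·ψ(b)` for all `b ∈ ℕ` — at a `b`
not prime to `NM` both sides vanish, since then `b` is not prime to `N` or not prime to `M`
(Washington Ch. 3: a Dirichlet character mod `n` is read on `ℤ` by `χ(a) = 0` for `(a, n) ≠ 1`,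
and `χψ` is the character with `χψ(a) = χ(a)ψ(a)` at the integers prime to both moduli).
[cite: Washington1997, Ch. 3 (p. 19, Dirichlet characters as functions on `ℤ`; the product `χψ`)] -/
theorem changeLevel_mul_changeLevel_apply_natCast {R : Type*} [CommMonoidWithZero R] {N M : ℕ}
    (χ : DirichletCharacter R N) (ψ : DirichletCharacter R M) (b : ℕ) :
    (changeLevel (dvd_mul_right N M) χ * changeLevel (dvd_mul_left M N) ψ :
      DirichletCharacter R (N * M)) (b : ZMod (N * M)) = χ (b : ZMod N) * ψ (b : ZMod M) := by
  by_cases hb : b.Coprime (N * M)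
  · have hu : IsCoprime (b : ℤ) ((N * M : ℕ) : ℤ) := Nat.isCoprime_iff_coprime.mpr hb
    have e : ((b : ℤ) : ZMod (N * M)) = (b : ZMod (N * M)) := by push_cast; rfl
    rw [← e, MulChar.mul_apply, changeLevel_eq_cast_of_dvd' _ _ hu,
      changeLevel_eq_cast_of_dvd' _ _ hu, Int.cast_natCast, Int.cast_natCast]
  · rw [MulChar.map_nonunit _ (by rwa [ZMod.isUnit_iff_coprime])]
    by_cases hbN : b.Coprime N
    · have hbM : ¬ b.Coprime M := fun h ↦ hb (Nat.Coprime.mul_right hbN h)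
      rw [MulChar.map_nonunit ψ (by rwa [ZMod.isUnit_iff_coprime]), mul_zero]
    · rw [MulChar.map_nonunit χ (by rwa [ZMod.isUnit_iff_coprime]), zero_mul]

/-- **`B_{1,χ↑ψ↑}` as Lang's `B_{1,f}` at level `NM`** with `f(b) = χ(b)ψ(b)` and the tree's
`bernoulliDist 1 (NM) b = B₁(b/NM)`: `B_{1,χ↑ψ↑} = ∑_{b mod NM} χ(b)ψ(b) B₁(b/NM)`.
[cite: LangCyclotomic1990, Ch. 2 §2, B 7 (the display `B_{k,f}`)] -/
theorem generalizedBernoulli_mul_eq_sum {N M : ℕ} [NeZero N] [NeZero M] {k : ℕ} (hk : 1 ≤ k)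
    (χ : DirichletCharacter ℚ_[p] N) (ψ : DirichletCharacter ℚ_[p] M) :
    generalizedBernoulli k (changeLevel (dvd_mul_right N M) χ * changeLevel (dvd_mul_left M N) ψ) =
      ∑ b : ZMod (N * M), χ (b.val : ZMod N) * ψ (b.val : ZMod M) *
        ((bernoulliDist k (N * M) b : ℚ) : ℚ_[p]) := by
  rw [generalizedBernoulli_eq_sum]
  refine Finset.sum_congr rfl fun b _ ↦ ?_
  rw [← changeLevel_mul_changeLevel_apply_natCast χ ψ b.val, ZMod.natCast_zmod_val,
    genBernoulliCoeff_of_one_le hk, eq_ratCast]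
  rfl

/-- **The level-`NM` sum of an `N`-periodic twist collapses to level `N`** (the distribution
relation of `E_k`, Lang Ch. 2 §2 **B 4**, summed against `f ∘ (ℤ/NM → ℤ/N)`):
`∑_{b mod NM} f(b mod N) (NM)^{k-1} B_k(b/NM) = ∑_{a mod N} f(a) N^{k-1} B_k(a/N)`, `k ≥ 1`.
[cite: LangCyclotomic1990, Ch. 2 §2, B 4 (distribution relation)] -/
theorem sum_castHom_mul_bernoulliDist_eq {N M : ℕ} [NeZero N] [NeZero M] {k : ℕ} (hk : 1 ≤ k)
    (F : ZMod N → ℚ_[p]) :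
    ∑ b : ZMod (N * M), F (ZMod.castHom (dvd_mul_right N M) (ZMod N) b) *
        ((bernoulliDist k (N * M) b : ℚ) : ℚ_[p]) =
      ∑ a : ZMod N, F a * ((bernoulliDist k N a : ℚ) : ℚ_[p]) := by
  classical
  rw [← Finset.sum_fiberwise Finset.univ (ZMod.castHom (dvd_mul_right N M) (ZMod N))
    (fun b : ZMod (N * M) ↦ F (ZMod.castHom (dvd_mul_right N M) (ZMod N) b) *
      ((bernoulliDist k (N * M) b : ℚ) : ℚ_[p]))]
  refine Finset.sum_congr rfl fun a _ ↦ ?_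
  have h : ∀ b ∈ Finset.univ.filter
      (fun b : ZMod (N * M) ↦ ZMod.castHom (dvd_mul_right N M) (ZMod N) b = a),
      F (ZMod.castHom (dvd_mul_right N M) (ZMod N) b) * ((bernoulliDist k (N * M) b : ℚ) : ℚ_[p]) =
        F a * ((bernoulliDist k (N * M) b : ℚ) : ℚ_[p]) := by
    intro b hb
    rw [(Finset.mem_filter.mp hb).2]
  rw [Finset.sum_congr rfl h, ← Finset.mul_sum, ← sum_fiber_bernoulliDist (dvd_mul_right N M) hk a,
    Rat.cast_sum]

/-- **`B_{k,χ}` as Lang's `B_{k,f}`**: `B_{k,χ} = ∑_{a mod N} χ(a) N^{k-1} B_k(a/N)` with the tree's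
`bernoulliDist`, `k ≥ 1`. [cite: LangCyclotomic1990, Ch. 2 §2, B 7] -/
theorem generalizedBernoulli_eq_sum_bernoulliDist {N : ℕ} [NeZero N] {k : ℕ} (hk : 1 ≤ k)
    (χ : DirichletCharacter ℚ_[p] N) :
    generalizedBernoulli k χ = ∑ a : ZMod N, χ a * ((bernoulliDist k N a : ℚ) : ℚ_[p]) := by
  rw [generalizedBernoulli_eq_sum]
  refine Finset.sum_congr rfl fun a _ ↦ ?_
  rw [genBernoulliCoeff_of_one_le hk, eq_ratCast]
  rfl

end Values

/-! ### §3. The twisted Kummer congruence -/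

section Main

variable {N : ℕ} [NeZero N]

/-- Transport of a level written in two ways. [folklore] -/
private theorem sum_level_eq {L L' : ℕ} [NeZero L] [NeZero L'] (h : L = L')
    (F : (T : ℕ) → ZMod T → ℚ_[p]) :
    ∑ b : ZMod L, F L b = ∑ b : ZMod L', F L' b := by
  subst h
  rfl

omit [NeZero N] in
/-- A choice of the auxiliary integer `c` (Lang: "Choose `c` to be a primitive root mod `p`"), here
also `≡ 1 (mod N)` so that `χ(c) = 1`: there is `c ∈ ℕ` prime to `Np·p` with `c ≡ 1 (mod N)` and
`c^k ≢ 1 (mod p)` for all `0 < k < p − 1`. [cite: LangCyclotomic1990, Ch. 2 §2, proof of Thm. 2.5] -/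
theorem exists_auxiliary (hN : N.Coprime p) :
    ∃ c : ℕ, c.Coprime (N * p * p) ∧ (c : ZMod N) = 1 ∧
      ∀ k : ℕ, 0 < k → k < p - 1 → ¬ ((p : ℤ) ∣ (1 - (c : ℤ) ^ k)) := by
  obtain ⟨g, hg⟩ := IsCyclic.exists_ofOrder_eq_natCard (α := (ZMod p)ˣ)
  rw [Nat.card_eq_fintype_card, ZMod.card_units] at hg
  obtain ⟨c, hc1, hcg⟩ := Nat.chineseRemainder hN 1 (g : ZMod p).val
  have hcg' : (c : ZMod p) = (g : ZMod p) := by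
    rw [(ZMod.natCast_eq_natCast_iff _ _ _).mpr hcg, ZMod.natCast_zmod_val]
  have hc1' : (c : ZMod N) = 1 := by
    rw [(ZMod.natCast_eq_natCast_iff _ _ _).mpr hc1, Nat.cast_one]
  have hcp : c.Coprime p := (ZMod.isUnit_iff_coprime c p).mp (by rw [hcg']; exact Units.isUnit g)
  have hcN : c.Coprime N := (ZMod.isUnit_iff_coprime c N).mp (by rw [hc1']; exact isUnit_one)
  refine ⟨c, (hcN.mul_right hcp).mul_right hcp, hc1', fun k hk0 hk h ↦ ?_⟩
  have hgk : g ^ k ≠ 1 := pow_ne_one_of_lt_orderOf (by omega) (by rw [hg]; omega)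
  rw [← ZMod.intCast_zmod_eq_zero_iff_dvd] at h
  push_cast at h
  rw [hcg', sub_eq_zero, ← Units.val_pow_eq_pow_val] at h
  exact hgk (Units.val_eq_one.mp h.symm)

/-- `‖1 − c^k‖_p = 1` when `p ∤ 1 − c^k`. [folklore] -/
private theorem norm_one_sub_pow_eq_one {c k : ℕ} (h : ¬ ((p : ℤ) ∣ (1 - (c : ℤ) ^ k))) :
    ‖(1 - (c : ℚ_[p]) ^ k)‖ = 1 := by
  have h1 := Padic.norm_int_le_one (p := p) (1 - (c : ℤ) ^ k)
  have h' : ¬ ‖((1 - (c : ℤ) ^ k : ℤ) : ℚ_[p])‖ < 1 := by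
    rw [Padic.norm_intCast_lt_one_iff]
    exact h
  push_cast at h1 h'
  exact le_antisymm h1 (not_lt.mp h')

/-- **`(1/k) B_{k,χ}` is `p`-integral** for `χ` modulo `N`, `p ∤ N`, `2 ≤ k ≤ p − 2` (the
integrality half of Lang's argument: `(1/k)(1 − χ(c)c^k) B_{k,χ} = ∫ χ x^{k-1} dE_{1,c}` is a
`p`-adic integer and `1 − χ(c)c^k = 1 − c^k` is a `p`-unit for `c ≡ 1 (mod N)` a primitive root
mod `p`; Washington Thm. 5.12/Cor. 5.13: `L_p(1−k, χω^k) ∈ ℤ_p`).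
[cite: LangCyclotomic1990, Ch. 2 §2, Thm. 2.4 and the proof of Thm. 2.5] [cite: Washington1997, Thm. 5.11 and Cor. 5.13] -/
theorem norm_generalizedBernoulli_div_le_one (hN : N.Coprime p) (χ : DirichletCharacter ℚ_[p] N)
    {k : ℕ} (h2k : 2 ≤ k) (hkp : k ≤ p - 2) :
    ‖(k : ℚ_[p])⁻¹ * generalizedBernoulli k χ‖ ≤ 1 := by
  have hp2 : p ≠ 2 := by omega
  have hk1 : 1 ≤ k := by omega
  obtain ⟨c, hc, hc1, hck⟩ := exists_auxiliary (p := p) hN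
  -- the twist `θ₂ = χ`, read as an `Np`-periodic function with values in `ℤ_p`
  set θ : ℕ → ℤ_[p] := fun b ↦ ⟨χ (b : ZMod N), norm_apply_le_one χ _⟩ with hθ_def
  have hθ : ∀ b, θ (b + N * p) = θ b := fun b ↦ by
    apply PadicInt.ext
    simp only [hθ_def, Nat.cast_add, Nat.cast_mul, ZMod.natCast_self, zero_mul, add_zero]
  have hθc : ∀ x, θ (c * x) = θ c * θ x := fun x ↦ by
    apply PadicInt.ext
    simp only [hθ_def, Nat.cast_mul, map_mul, PadicInt.coe_mul]
  -- Thm. 2.4 at tame level `Np`, then the level-`Np` sum collapses to `B_{k,χ}`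
  have hM := bernoulliMeasure_zero_eq p (N := N * p) (θ := θ) hc hθ hθc k
  have hNp : N * p * p ^ 0 = N * p := by rw [pow_zero, mul_one]
  have h0 : ∑ b : ZMod (N * p * p ^ 0), ((θ b.val : ℤ_[p]) : ℚ_[p]) *
      ((bernoulliDist k (N * p * p ^ 0) b : ℚ) : ℚ_[p]) =
      ∑ b : ZMod (N * p), ((θ b.val : ℤ_[p]) : ℚ_[p]) * ((bernoulliDist k (N * p) b : ℚ) : ℚ_[p]) :=
    sum_level_eq hNp (fun T b ↦ ((θ b.val : ℤ_[p]) : ℚ_[p]) * ((bernoulliDist k T b : ℚ) : ℚ_[p]))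
  have hsum : ∑ b : ZMod (N * p * p ^ 0), ((θ b.val : ℤ_[p]) : ℚ_[p]) *
      ((bernoulliDist k (N * p * p ^ 0) b : ℚ) : ℚ_[p]) = generalizedBernoulli k χ := by
    rw [h0, generalizedBernoulli_eq_sum_bernoulliDist hk1,
      ← sum_castHom_mul_bernoulliDist_eq (M := p) hk1 (fun a ↦ χ a)]
    refine Finset.sum_congr rfl fun b _ ↦ ?_
    simp only [hθ_def, ZMod.castHom_apply, ZMod.cast_eq_val]
  have hθc1 : ((θ c : ℤ_[p]) : ℚ_[p]) = 1 := by simp [hθ_def, hc1]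
  rw [hsum, hθc1, one_mul] at hM
  have hint := TeichmullerTwist.norm_bernoulliMeasure_zero_le_one (N := N * p) (θ := θ) (k := k)
    hp2 hc hθ hk1
  have hu : ‖(1 - (c : ℚ_[p]) ^ k)‖ = 1 := norm_one_sub_pow_eq_one (hck k (by omega) (by omega))
  have e : bernoulliMeasure p (N * p) c θ k 0 0 =
      (1 - (c : ℚ_[p]) ^ k) * ((k : ℚ_[p])⁻¹ * generalizedBernoulli k χ) := by
    rw [hM]; ring
  rw [e, norm_mul, hu, one_mul] at hint
  exact hint

/-- **Lang Ch. 2 §2 Theorem 2.5 with a tame twist / Washington Thm. 5.11 + Cor. 5.13 at `s = 0`: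
`B_{1,χω^{k-1}} ≡ (1/k) B_{k,χ} (mod p)`.**  For an odd prime `p`, `N` prime to `p`, a Dirichlet
character `χ` modulo `N` with values in `ℚ_p`, the Teichmüller character `ω` modulo `p`
(`‖ω(a) − a‖_p < 1` for `p ∤ a`; Lang: "`ω(a) ≡ a (mod p)`") and `2 ≤ k ≤ p − 2`:
`‖B_{1,χω^{k-1}} − (1/k) B_{k,χ}‖_p < 1`, where `χω^{k-1}` is the character
`changeLevel χ * changeLevel ω^{k-1}` modulo `Np` and `B_{·,·}` is the tree's
`LFunctions.generalizedBernoulli`.  (`χ = 1`, `N = 1` is Lang's printed statement at `n = 1`,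
`B_{1,ω^{k-1}} ≡ (1/k)B_k`, up to the factor `1 − p^{k−1} ≡ 1`; for `k ≥ 2` Washington's Euler factor
`1 − χ(p)p^{k−1}` is `≡ 1` and is omitted.)
[cite: LangCyclotomic1990, Ch. 2 §2, Thms 2.4–2.5 and their proofs; Ch. 4 §3 Thm. 3.2] [cite: Washington1997, Thm. 5.11 and Cor. 5.13] -/
theorem norm_generalizedBernoulli_one_sub_div_lt_one (hN : N.Coprime p)
    (χ : DirichletCharacter ℚ_[p] N) (ω : DirichletCharacter ℚ_[p] p)
    (hω : ∀ a : ℤ, ¬ ((p : ℤ) ∣ a) → ‖ω (a : ZMod p) - (a : ℚ_[p])‖ < 1)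
    {k : ℕ} (h2k : 2 ≤ k) (hkp : k ≤ p - 2) :
    ‖generalizedBernoulli 1 (changeLevel (dvd_mul_right N p) χ *
          changeLevel (dvd_mul_left p N) (ω ^ (k - 1))) -
        (k : ℚ_[p])⁻¹ * generalizedBernoulli k χ‖ < 1 := by
  have hp2 : p ≠ 2 := by omega
  have hp1 : (1 : ℝ) < p := by exact_mod_cast hp.out.one_lt
  have hk1 : 1 ≤ k := by omega
  have hk0 : k - 1 ≠ 0 := by omega
  obtain ⟨c, hc, hc1, hck⟩ := exists_auxiliary (p := p) hN
  set ψ : DirichletCharacter ℚ_[p] p := ω ^ (k - 1) with hψ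
  -- the two twists, as `Np`-periodic functions on `ℕ` with values in `ℤ_p`
  set θ : ℕ → ℤ_[p] := fun b ↦ ⟨χ (b : ZMod N) * ψ (b : ZMod p),
    (norm_mul_le _ _).trans (mul_le_one₀ (norm_apply_le_one χ _) (norm_nonneg _)
      (norm_apply_le_one ψ _))⟩ with hθ_def
  set θ' : ℕ → ℤ_[p] := fun b ↦ ⟨χ (b : ZMod N), norm_apply_le_one χ _⟩ with hθ'_def
  have hθ : ∀ b, θ (b + N * p) = θ b := fun b ↦ by
    apply PadicInt.ext
    simp only [hθ_def, Nat.cast_add, Nat.cast_mul, ZMod.natCast_self, zero_mul, mul_zero,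
      add_zero]
  have hθ' : ∀ b, θ' (b + N * p) = θ' b := fun b ↦ by
    apply PadicInt.ext
    simp only [hθ'_def, Nat.cast_add, Nat.cast_mul, ZMod.natCast_self, zero_mul, add_zero]
  have hθc : ∀ x, θ (c * x) = θ c * θ x := fun x ↦ by
    apply PadicInt.ext
    simp only [hθ_def, Nat.cast_mul, map_mul, PadicInt.coe_mul]
    ring
  have hθ'c : ∀ x, θ' (c * x) = θ' c * θ' x := fun x ↦ by
    apply PadicInt.ext
    simp only [hθ'_def, Nat.cast_mul, map_mul, PadicInt.coe_mul]
  -- congruence of the integrands: `x^0 θ(y) ≡ x^{k-1} θ'(y) (mod p)` for `x ≡ y (mod p)`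
  have H : ∀ x y : ℕ, x ≡ y [MOD p] →
      ‖((x : ℤ_[p]) ^ 0 * θ y - (x : ℤ_[p]) ^ (k - 1) * θ' y)‖ ≤ (p : ℝ)⁻¹ := by
    intro x y hxy
    refine norm_le_inv_of_dvd ?_
    by_cases hy : (p : ℤ) ∣ (y : ℤ)
    · -- both sides vanish modulo `p`: `ψ(y) = 0` and `p ∣ x`
      have hy0 : ((y : ℕ) : ZMod p) = 0 := by
        rw [← Int.cast_natCast, ZMod.intCast_zmod_eq_zero_iff_dvd]
        exact hy
      have hx0 : ((x : ℕ) : ZMod p) = 0 := by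
        rw [(ZMod.natCast_eq_natCast_iff _ _ _).mpr hxy, hy0]
      have hx : (p : ℤ_[p]) ∣ (x : ℤ_[p]) :=
        Nat.cast_dvd_cast ((ZMod.natCast_eq_zero_iff x p).mp hx0)
      have hψ0 : ψ (0 : ZMod p) = 0 := ψ.map_nonunit not_isUnit_zero
      have hθy : θ y = 0 := by
        apply PadicInt.ext
        simp [hθ_def, hy0, hψ0]
      rw [hθy, mul_zero, zero_sub, dvd_neg]
      exact Dvd.dvd.mul_right (dvd_pow hx hk0) _
    · -- `p ∤ y`: `ψ(y) = ω(y)^{k-1} ≡ y^{k-1} ≡ x^{k-1}`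
      set Y : ℤ_[p] := ⟨ω ((y : ℤ) : ZMod p), norm_apply_le_one ω _⟩ with hY
      have hYy : (p : ℤ_[p]) ∣ Y - (y : ℤ_[p]) := by
        rw [← PadicInt.norm_lt_one_iff_dvd, PadicInt.norm_def, PadicInt.coe_sub]
        simpa [hY] using hω y hy
      have hyx : (p : ℤ_[p]) ∣ (y : ℤ_[p]) - (x : ℤ_[p]) := by
        have h := map_dvd (Int.castRingHom ℤ_[p]) hxy.dvd
        simpa using h
      have hYx : (p : ℤ_[p]) ∣ Y - (x : ℤ_[p]) := by
        have h := dvd_add hYy hyx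
        rwa [sub_add_sub_cancel] at h
      have hYxk : (p : ℤ_[p]) ∣ Y ^ (k - 1) - (x : ℤ_[p]) ^ (k - 1) :=
        dvd_trans hYx (sub_dvd_pow_sub_pow _ _ _)
      have hθy : θ y = θ' y * Y ^ (k - 1) := by
        apply PadicInt.ext
        simp [hθ_def, hθ'_def, hY, hψ, MulChar.pow_apply' _ hk0]
      rw [hθy, pow_zero, one_mul, mul_comm ((x : ℤ_[p]) ^ (k - 1)) (θ' y), ← mul_sub]
      exact Dvd.dvd.mul_left hYxk _
  -- congruence and integrality of the total masses
  have hcong := norm_bernoulliMeasure_zero_sub_lt_one_level (M := N * p) (c := c) (θ := θ)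
    (θ' := θ') hp2 hc hθ hθ' (i := 0) (j := k - 1) H
  rw [zero_add, Nat.sub_add_cancel hk1] at hcong
  have hint := TeichmullerTwist.norm_bernoulliMeasure_zero_le_one (N := N * p) (θ := θ) (k := 1)
    hp2 hc hθ le_rfl
  have hint' := TeichmullerTwist.norm_bernoulliMeasure_zero_le_one (N := N * p) (θ := θ') (k := k)
    hp2 hc hθ' hk1
  -- the total masses by Thm. 2.4
  have hM := bernoulliMeasure_zero_eq p (N := N * p) (θ := θ) hc hθ hθc 1
  have hM' := bernoulliMeasure_zero_eq p (N := N * p) (θ := θ') hc hθ' hθ'c k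
  have hNp : N * p * p ^ 0 = N * p := by rw [pow_zero, mul_one]
  have h0 : ∑ b : ZMod (N * p * p ^ 0), ((θ b.val : ℤ_[p]) : ℚ_[p]) *
      ((bernoulliDist 1 (N * p * p ^ 0) b : ℚ) : ℚ_[p]) =
      ∑ b : ZMod (N * p), ((θ b.val : ℤ_[p]) : ℚ_[p]) * ((bernoulliDist 1 (N * p) b : ℚ) : ℚ_[p]) :=
    sum_level_eq hNp (fun T b ↦ ((θ b.val : ℤ_[p]) : ℚ_[p]) * ((bernoulliDist 1 T b : ℚ) : ℚ_[p]))
  have h0' : ∑ b : ZMod (N * p * p ^ 0), ((θ' b.val : ℤ_[p]) : ℚ_[p]) *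
      ((bernoulliDist k (N * p * p ^ 0) b : ℚ) : ℚ_[p]) =
      ∑ b : ZMod (N * p), ((θ' b.val : ℤ_[p]) : ℚ_[p]) * ((bernoulliDist k (N * p) b : ℚ) : ℚ_[p]) :=
    sum_level_eq hNp (fun T b ↦ ((θ' b.val : ℤ_[p]) : ℚ_[p]) * ((bernoulliDist k T b : ℚ) : ℚ_[p]))
  have hsum : ∑ b : ZMod (N * p * p ^ 0), ((θ b.val : ℤ_[p]) : ℚ_[p]) *
      ((bernoulliDist 1 (N * p * p ^ 0) b : ℚ) : ℚ_[p]) =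
      generalizedBernoulli 1 (changeLevel (dvd_mul_right N p) χ *
        changeLevel (dvd_mul_left p N) ψ) := by
    rw [h0, generalizedBernoulli_mul_eq_sum le_rfl]
  have hsum' : ∑ b : ZMod (N * p * p ^ 0), ((θ' b.val : ℤ_[p]) : ℚ_[p]) *
      ((bernoulliDist k (N * p * p ^ 0) b : ℚ) : ℚ_[p]) = generalizedBernoulli k χ := by
    rw [h0', generalizedBernoulli_eq_sum_bernoulliDist hk1,
      ← sum_castHom_mul_bernoulliDist_eq (M := p) hk1 (fun a ↦ χ a)]
    refine Finset.sum_congr rfl fun b _ ↦ ?_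
    simp only [hθ'_def, ZMod.castHom_apply, ZMod.cast_eq_val]
  have hθcv : ((θ c : ℤ_[p]) : ℚ_[p]) = ψ (c : ZMod p) := by simp [hθ_def, hc1]
  have hθ'c1 : ((θ' c : ℤ_[p]) : ℚ_[p]) = 1 := by simp [hθ'_def, hc1]
  rw [hsum, hθcv, Nat.cast_one, inv_one, one_mul, pow_one] at hM
  rw [hsum', hθ'c1, one_mul] at hM'
  -- names
  set X := generalizedBernoulli 1 (changeLevel (dvd_mul_right N p) χ *
    changeLevel (dvd_mul_left p N) ψ) with hX
  set Y := (k : ℚ_[p])⁻¹ * generalizedBernoulli k χ with hY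
  set u₁ : ℚ_[p] := 1 - ψ (c : ZMod p) * (c : ℚ_[p]) with hu₁
  set u₂ : ℚ_[p] := 1 - (c : ℚ_[p]) ^ k with hu₂
  have hμ : bernoulliMeasure p (N * p) c θ 1 0 0 = u₁ * X := by rw [hM]
  have hμ' : bernoulliMeasure p (N * p) c θ' k 0 0 = u₂ * Y := by
    rw [hM', hY, hu₂]
    ring
  -- `u₂` is a `p`-unit, `u₁ ≡ u₂ (mod p)`, hence `u₁` is a `p`-unit
  have hu₂n : ‖u₂‖ = 1 := norm_one_sub_pow_eq_one (hck k (by omega) (by omega))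
  have hcp : ¬ ((p : ℤ) ∣ (c : ℤ)) := by
    rw [Int.natCast_dvd_natCast, ← hp.out.coprime_iff_not_dvd]
    exact (Nat.Coprime.coprime_mul_left_right hc).symm
  have hu₁₂ : ‖u₁ - u₂‖ < 1 := by
    have e : u₁ - u₂ = (c : ℚ_[p]) * ((c : ℚ_[p]) ^ (k - 1) - ψ (c : ZMod p)) := by
      rw [hu₁, hu₂]
      have : (c : ℚ_[p]) ^ k = (c : ℚ_[p]) * (c : ℚ_[p]) ^ (k - 1) := by
        rw [← pow_succ', Nat.sub_add_cancel hk1]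
      rw [this]
      ring
    rw [e, norm_mul]
    have hc1n : ‖(c : ℚ_[p])‖ ≤ 1 := by exact_mod_cast Padic.norm_int_le_one (c : ℤ)
    have hω' : ‖(c : ℚ_[p]) ^ (k - 1) - ψ (c : ZMod p)‖ < 1 := by
      set C : ℤ_[p] := ⟨ω ((c : ℤ) : ZMod p), norm_apply_le_one ω _⟩ with hC
      have hCc : (p : ℤ_[p]) ∣ C - (c : ℤ_[p]) := by
        rw [← PadicInt.norm_lt_one_iff_dvd, PadicInt.norm_def, PadicInt.coe_sub]
        simpa [hC] using hω c hcp
      have hd : (p : ℤ_[p]) ∣ C ^ (k - 1) - (c : ℤ_[p]) ^ (k - 1) :=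
        dvd_trans hCc (sub_dvd_pow_sub_pow _ _ _)
      have hn : ‖C ^ (k - 1) - (c : ℤ_[p]) ^ (k - 1)‖ < 1 :=
        (norm_le_inv_of_dvd hd).trans_lt (inv_lt_one_of_one_lt₀ hp1)
      rw [PadicInt.norm_def, PadicInt.coe_sub, PadicInt.coe_pow, PadicInt.coe_pow] at hn
      rw [← norm_neg, neg_sub, hψ, MulChar.pow_apply' _ hk0]
      simpa [hC, Int.cast_natCast] using hn
    calc ‖(c : ℚ_[p])‖ * ‖(c : ℚ_[p]) ^ (k - 1) - ψ (c : ZMod p)‖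
        ≤ 1 * ‖(c : ℚ_[p]) ^ (k - 1) - ψ (c : ZMod p)‖ := by gcongr
      _ < 1 := by rw [one_mul]; exact hω'
  have hu₁n : ‖u₁‖ = 1 := by
    have e : u₁ = u₂ + (u₁ - u₂) := by ring
    rw [e, IsUltrametricDist.norm_add_eq_max_of_norm_ne_norm, hu₂n, max_eq_left hu₁₂.le]
    rw [hu₂n]
    exact (ne_of_lt hu₁₂).symm
  have hu₁0 : u₁ ≠ 0 := norm_pos_iff.mp (by rw [hu₁n]; exact one_pos)
  -- `Y` is `p`-integral
  have hYn : ‖Y‖ ≤ 1 := by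
    have h := hint'
    rw [hμ', norm_mul, hu₂n, one_mul] at h
    exact h
  -- `X − Y = u₁⁻¹ ((μ − μ') + (u₂ − u₁) Y)`
  have e : X - Y = u₁⁻¹ * ((bernoulliMeasure p (N * p) c θ 1 0 0 -
      bernoulliMeasure p (N * p) c θ' k 0 0) + (u₂ - u₁) * Y) := by
    rw [hμ, hμ']
    field_simp
    ring
  rw [e, norm_mul, norm_inv, hu₁n, inv_one, one_mul]
  refine (IsUltrametricDist.norm_add_le_max _ _).trans_lt (max_lt hcong ?_)
  rw [norm_mul]
  calc ‖u₂ - u₁‖ * ‖Y‖ ≤ ‖u₂ - u₁‖ * 1 := by gcongr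
    _ < 1 := by rw [mul_one, ← norm_neg, neg_sub]; exact hu₁₂

/-- **`B_{1,χω^{k-1}}` is `p`-integral** (`2 ≤ k ≤ p − 2`, `p ∤ N`): from the congruence and the
integrality of `(1/k)B_{k,χ}`. [cite: LangCyclotomic1990, Ch. 2 §2, Thm. 2.5 and Cor. 1 of Thm. 2.3 ("… and are p-integral")] -/
theorem norm_generalizedBernoulli_one_le_one (hN : N.Coprime p)
    (χ : DirichletCharacter ℚ_[p] N) (ω : DirichletCharacter ℚ_[p] p)
    (hω : ∀ a : ℤ, ¬ ((p : ℤ) ∣ a) → ‖ω (a : ZMod p) - (a : ℚ_[p])‖ < 1)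
    {k : ℕ} (h2k : 2 ≤ k) (hkp : k ≤ p - 2) :
    ‖generalizedBernoulli 1 (changeLevel (dvd_mul_right N p) χ *
        changeLevel (dvd_mul_left p N) (ω ^ (k - 1)))‖ ≤ 1 := by
  have h1 := norm_generalizedBernoulli_one_sub_div_lt_one hN χ ω hω h2k hkp
  have h2 := norm_generalizedBernoulli_div_le_one hN χ h2k hkp
  set X := generalizedBernoulli 1 (changeLevel (dvd_mul_right N p) χ *
    changeLevel (dvd_mul_left p N) (ω ^ (k - 1)))
  set Y := (k : ℚ_[p])⁻¹ * generalizedBernoulli k χ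
  have e : X = (X - Y) + Y := by ring
  rw [e]
  exact (IsUltrametricDist.norm_add_le_max _ _).trans (max_le h1.le h2)

/-- **`p ∣ B_{1,χω^{k-1}} ⟺ p ∣ (1/k) B_{k,χ}`** (`2 ≤ k ≤ p − 2`, `p ∤ N`), both divisibilities
read as `‖·‖_p < 1` on the `p`-integral numbers of the two previous theorems — the form in which a
Bernoulli-unit hypothesis on the character `χω^{k-1}` (Herbrand–Ribet / Mazur–Wiles / Kriz–Li type)
becomes a statement about `B_{k,χ}/k = −L(1−k, χ)`.
[cite: LangCyclotomic1990, Ch. 2 §2, Thm. 2.5; Ch. 1 §3, proof of Cor. 3] [cite: Washington1997, Thm. 5.11 and Cor. 5.13] -/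
theorem norm_generalizedBernoulli_one_lt_one_iff (hN : N.Coprime p)
    (χ : DirichletCharacter ℚ_[p] N) (ω : DirichletCharacter ℚ_[p] p)
    (hω : ∀ a : ℤ, ¬ ((p : ℤ) ∣ a) → ‖ω (a : ZMod p) - (a : ℚ_[p])‖ < 1)
    {k : ℕ} (h2k : 2 ≤ k) (hkp : k ≤ p - 2) :
    ‖generalizedBernoulli 1 (changeLevel (dvd_mul_right N p) χ *
        changeLevel (dvd_mul_left p N) (ω ^ (k - 1)))‖ < 1 ↔
      ‖(k : ℚ_[p])⁻¹ * generalizedBernoulli k χ‖ < 1 := by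
  have h1 := norm_generalizedBernoulli_one_sub_div_lt_one hN χ ω hω h2k hkp
  set X := generalizedBernoulli 1 (changeLevel (dvd_mul_right N p) χ *
    changeLevel (dvd_mul_left p N) (ω ^ (k - 1)))
  set Y := (k : ℚ_[p])⁻¹ * generalizedBernoulli k χ
  constructor
  · intro hX
    have e : Y = X - (X - Y) := by ring
    rw [e]
    have hsub : ∀ x y : ℚ_[p], ‖x - y‖ ≤ max ‖x‖ ‖y‖ := fun x y ↦ by
      simpa only [sub_eq_add_neg, norm_neg] using IsUltrametricDist.norm_add_le_max x (-y)
    exact (hsub _ _).trans_lt (max_lt hX h1)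
  · intro hY
    have e : X = (X - Y) + Y := by ring
    rw [e]
    exact (IsUltrametricDist.norm_add_le_max _ _).trans_lt (max_lt h1 hY)

end Main

end Literature.NumberTheory.Congruences.CharacterTwist

end
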